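import Mathlib
import Summits.Ventures.PercRepro2.V2SP
import Summits.Ventures.PercRepro2.Tail2DP2SeriesSP
import Summits.Ventures.PercRepro2.Tail2DSymUni

/-!
# Cellwise anti-diagonal unimodality (CAU) is closed under parallel composition
(seat mine-b, cell pub-perc-repro2; MINE-B.md §39.6)

For a pattern `s` of the cell's grammar let `N(i,b) = #{r = i ∧ b = b}` (`ncell`).  CAU says
`N(i,b) ≤ N(i+1,b−1)` whenever `b ≥ i+2`: on every level `n = r + b` the sequence `i ↦ N(i, n−i)`, symmetric
about `n/2` by the colour swap, is non-decreasing up to the middle.  It is census-true on every pattern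
without pins (≤ 14 free edges) and on every two-terminal graph with ≤ 6 vertices, and it implies STEP and the
whole anti-diagonal unimodality of the tails (§39.6).  Here its PARALLEL step: the level-`n` sequence of
`s ∥ t` is `Σ_{n₁+n₂=n} (level n₁ of s) ∗ (level n₂ of t)` (`lvl_par`, through the cell convolution
`ncell_par`), a sum of convolutions of symmetric unimodal sequences with the common centre `n/2`, each
non-decreasing on the left half by `conv_mono` (`Tail2DSymUni.lean`); hence `cau_par : CAU s → CAU t →
CAU (par s t)`.  The series step of CAU is the open item (it is not closed at the array level, §39.6).
-/

namespace Summit.Ventures.PercRepro2.Tail2D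

open V2Closure Summit.Ventures.PercRepro2.Unimodal

section Cells

variable (s : V2Closure.SP)

/-- the cell count `N(i,b) = #{r = i ∧ b = b}` -/
def ncell (i b : ℕ) : ℕ := (Finset.univ.filter (fun y : s.Conf => s.rLab y = i ∧ s.bLab y = b)).card

/-- **cellwise anti-diagonal unimodality**: `N(i,b) ≤ N(i+1,b−1)` whenever `b ≥ i+2` -/
def CAU : Prop := ∀ i b, i + 2 ≤ b → ncell s i b ≤ ncell s (i + 1) (b - 1)

/-- `N(i,b) = N(b,i)` (the colour swap) -/
lemma ncell_symm (i b : ℕ) : ncell s i b = ncell s b i := by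
  unfold ncell
  rw [← card_swap s (fun r b' => r = b ∧ b' = i)]
  congr 1; ext y; simp only [Finset.mem_filter, Finset.mem_univ, true_and]; exact and_comm

/-- the level-`n` sequence `i ↦ N(i, n−i)` (zero beyond `n`) -/
def lvl (n i : ℕ) : ℕ := if i ≤ n then ncell s i (n - i) else 0

/-- under CAU every level sequence is symmetric unimodal -/
lemma lvl_symUni (h : CAU s) (n : ℕ) : SymUni (lvl s n) n where
  zero := fun i hi => by unfold lvl; simp [Nat.not_le.2 hi]
  symm := fun i hi => by
    unfold lvl
    simp only [hi, if_true, Nat.sub_le, show n - (n - i) = i by omega]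
    exact ncell_symm s i (n - i)
  mono := fun i hi => by
    unfold lvl
    simp only [show i ≤ n by omega, show i + 1 ≤ n by omega, if_true]
    have := h i (n - i) (by omega)
    rw [show n - (i + 1) = n - i - 1 by omega]
    exact this

end Cells

section Parallel

variable (s t : V2Closure.SP)

/-- a triple sum with the innermost index moved outside -/
lemma sum_sum_sum_comm {α β γ : Type*} (A : Finset α) (B : Finset β) (C : Finset γ) (f : α → β → γ → ℕ) :
    ∑ a ∈ A, ∑ b ∈ B, ∑ c ∈ C, f a b c = ∑ c ∈ C, ∑ a ∈ A, ∑ b ∈ B, f a b c := by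
  calc ∑ a ∈ A, ∑ b ∈ B, ∑ c ∈ C, f a b c = ∑ a ∈ A, ∑ c ∈ C, ∑ b ∈ B, f a b c :=
        Finset.sum_congr rfl (fun a _ => Finset.sum_comm)
    _ = ∑ c ∈ C, ∑ a ∈ A, ∑ b ∈ B, f a b c := Finset.sum_comm

/-- the cells of a parallel composition, fibred over the first factor:
`N″(i,b) = Σ_x [r_x ≤ i ∧ b_x ≤ b] · N_t(i − r_x, b − b_x)` -/
lemma ncell_par_fibre (i b : ℕ) :
    ncell (V2Closure.SP.par s t) i b
      = ∑ x : s.Conf, if s.rLab x ≤ i ∧ s.bLab x ≤ b then ncell t (i - s.rLab x) (b - s.bLab x) else 0 := by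
  unfold ncell
  rw [Finset.card_filter]
  rw [show (∑ y : (V2Closure.SP.par s t).Conf,
        if (V2Closure.SP.par s t).rLab y = i ∧ (V2Closure.SP.par s t).bLab y = b then 1 else 0)
      = ∑ x : s.Conf, ∑ y : t.Conf, if s.rLab x + t.rLab y = i ∧ s.bLab x + t.bLab y = b then 1 else 0 from
    Fintype.sum_prod_type (fun p : s.Conf × t.Conf => if s.rLab p.1 + t.rLab p.2 = i ∧ s.bLab p.1 + t.bLab p.2 = b then 1 else 0)]
  refine Finset.sum_congr rfl (fun x _ => ?_)
  split_ifs with h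
  · rw [Finset.card_filter]
    refine Finset.sum_congr rfl (fun y _ => ?_)
    split_ifs <;> omega
  · refine Finset.sum_eq_zero (fun y _ => ?_)
    split_ifs <;> omega

/-- the cells of a parallel composition: the convolution of the cells of the factors -/
lemma ncell_par (i b : ℕ) :
    ncell (V2Closure.SP.par s t) i b
      = ∑ i₁ ∈ Finset.range (i + 1), ∑ b₁ ∈ Finset.range (b + 1), ncell s i₁ b₁ * ncell t (i - i₁) (b - b₁) := by
  have hR : ∀ i₁ b₁, ncell s i₁ b₁ * ncell t (i - i₁) (b - b₁)
      = ∑ x : s.Conf, if (s.rLab x, s.bLab x) = (i₁, b₁) then ncell t (i - i₁) (b - b₁) else 0 := by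
    intro i₁ b₁
    rw [show ncell s i₁ b₁ = ∑ x : s.Conf, if s.rLab x = i₁ ∧ s.bLab x = b₁ then 1 else 0 from by
      unfold ncell; rw [Finset.card_filter]]
    rw [Finset.sum_mul]
    refine Finset.sum_congr rfl (fun x _ => ?_)
    simp only [Prod.mk.injEq]
    split_ifs <;> simp_all
  simp_rw [hR]
  rw [sum_sum_sum_comm, ncell_par_fibre]
  refine Finset.sum_congr rfl (fun x _ => ?_)
  rw [← Finset.sum_product' (Finset.range (i + 1)) (Finset.range (b + 1))
    (fun i₁ b₁ => if (s.rLab x, s.bLab x) = (i₁, b₁) then ncell t (i - i₁) (b - b₁) else 0)]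
  rw [Finset.sum_ite_eq (Finset.range (i + 1) ×ˢ Finset.range (b + 1)) (s.rLab x, s.bLab x)
    (fun p => ncell t (i - p.1) (b - p.2))]
  simp only [Finset.mem_product, Finset.mem_range]
  split_ifs <;> omega

/-- the level-`n` sequence of a parallel composition is the sum over `n₁` of the convolutions of the level-`n₁`
sequence of the first factor with the level-`(n−n₁)` sequence of the second -/
lemma lvl_par (n i : ℕ) (hi : i ≤ n) :
    lvl (V2Closure.SP.par s t) n i = ∑ n₁ ∈ Finset.range (n + 1), conv (lvl s n₁) (lvl t (n - n₁)) i := by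
  unfold lvl
  simp only [hi, if_true]
  rw [ncell_par]
  unfold conv
  rw [Finset.sum_comm (s := Finset.range (n + 1)) (t := Finset.range (i + 1))]
  refine Finset.sum_congr rfl (fun i₁ hi₁ => ?_)
  simp only [Finset.mem_range] at hi₁
  -- the `n₁`-sum is supported on `i₁ ≤ n₁ ≤ n − i + i₁`
  have hsub : Finset.Ico i₁ (n - i + i₁ + 1) ⊆ Finset.range (n + 1) := by
    intro k hk; simp only [Finset.mem_Ico, Finset.mem_range] at hk ⊢; omega
  have hzero : ∀ k ∈ Finset.range (n + 1), k ∉ Finset.Ico i₁ (n - i + i₁ + 1) →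
      (if i₁ ≤ k then ncell s i₁ (k - i₁) else 0) * (if i - i₁ ≤ n - k then ncell t (i - i₁) (n - k - (i - i₁)) else 0) = 0 := by
    intro k hk hk'
    simp only [Finset.mem_range, Finset.mem_Ico, not_and_or, not_le] at hk hk'
    rcases hk' with h1 | h2
    · simp [Nat.not_le.2 h1]
    · simp [show ¬ (i - i₁ ≤ n - k) by omega]
  rw [← Finset.sum_subset hsub hzero, Finset.sum_Ico_eq_sum_range,
    show n - i + i₁ + 1 - i₁ = n - i + 1 by omega]
  refine Finset.sum_congr rfl (fun k hk => ?_)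
  simp only [Finset.mem_range] at hk
  simp only [show i₁ ≤ i₁ + k by omega, show i - i₁ ≤ n - (i₁ + k) by omega, if_true,
    show i₁ + k - i₁ = k by omega, show n - (i₁ + k) - (i - i₁) = n - i - k by omega]

/-- **CAU is closed under parallel composition**: the level sequences of `s ∥ t` are sums of convolutions
of symmetric unimodal sequences with the common centre `n/2` -/
theorem cau_par (hs : CAU s) (ht : CAU t) : CAU (V2Closure.SP.par s t) := by
  intro i b hib
  have h1 : ncell (V2Closure.SP.par s t) i b = lvl (V2Closure.SP.par s t) (i + b) i := by
    unfold lvl; simp only [show i ≤ i + b by omega, if_true, Nat.add_sub_cancel_left]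
  have h2 : ncell (V2Closure.SP.par s t) (i + 1) (b - 1) = lvl (V2Closure.SP.par s t) (i + b) (i + 1) := by
    unfold lvl; simp only [show i + 1 ≤ i + b by omega, if_true, show i + b - (i + 1) = b - 1 by omega]
  rw [h1, h2, lvl_par s t (i + b) i (by omega), lvl_par s t (i + b) (i + 1) (by omega)]
  refine Finset.sum_le_sum (fun n₁ hn₁ => ?_)
  simp only [Finset.mem_range] at hn₁
  exact conv_mono n₁ (lvl_symUni s hs n₁) (lvl_symUni t ht (i + b - n₁)) i (by omega)

end Parallel

end Summit.Ventures.PercRepro2.Tail2D
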